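import Literature.Probability.Percolation.FourArmGarbanTwoArms
import Literature.Probability.Percolation.LatticeSymmetry
import HarnessLib

/-!
# Pivotal edges of the square crossing carry four alternating arms (bond percolation on `ℤ²`)

Topic `Literature/Probability/Percolation`. A bottom-up layer towards the named fact
`Kesten1987_zdKestenRelation` (`ZdNearCriticalWindow.lean`, not imported here), proofs only (no definition, no
named fact). Nolin 2008, §7.3 [arXiv 0711.4948], first paragraph: the sites pivotal for the
crossing `𝒞_H([0,N]²)` "are exactly those for which the `4`-arm event `Ā_{4,σ₄}^{·/Ī}` with
alternating colors (`σ₄ = BWBW`) and sides (`Ī` = right, top, left and bottom sides)" occurs,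
whence, in the proof of Prop. 32, `P̂(v pivotal) ≤ P̂(v ⇝^{4,σ₄} ∂S_{ηL(p)}(v))` for the sites `v`
at distance `≥ ηL(p)` from the boundary (Werner 2009, Lecture 6, proof of Lemma 6.2, same step).
This file proves the bond-`ℤ²` version of that inclusion for the tree's cluster form of the
four-arm event (`fourArmTwoClusters`, `FourArmGarban.lean`) and the resulting probability bound:

* `ZdPivotal.mem_of_reachable_of_closed` — a set of vertices closed under adjacency contains
  everything reachable from it (the "cut" argument; pivotality for the increasing crossing event
  is read as `ω ∪ {e} ∈ A`, `ω ∖ {e} ∉ A`, cf. `isPivotal_iff_insert_mem_and_notMem` of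
  `ParaPivotalArms.lean`, not imported to keep this bond-`ℤ²` file free of the site-`𝕋` tree);
* `exists_endpoints_of_isPivotal_lrCrossing` — **a pivotal edge separates the left cluster from
  the right cluster**: if `e` is pivotal for `LR([0,N]²)` in `ω`, then `e = {a, b}` where, in
  `ω ∖ {e}` and inside the square, `a` is joined to the left side and not to the right side,
  `b` is joined to the right side and not to the left side;
* `relabel_mem_fourArmTwoClusters_of_arms` — **four arms around an endpoint**: if moreover the
  box `a + [-d,d]²` lies in the square (`d ≥ 1`), the two open paths leave `a + [-d,d]²`, avoid
  each other's cluster inside the punctured box, and the configuration translated by `-a` lies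
  in `fourArmTwoClusters 1 d` (first-exit surgery `exists_prefix_exit`);
* `real_isPivotal_lrCrossing_le` — **`P_t(e pivotal for LR([0,N]²)) ≤ 2 · α₄,ₜ(1, d)`** for every
  lattice edge `e = {u, v}` both of whose endpoints are at sup-distance `≥ d` from the complement
  of the square (translation invariance, `bondPercolation_real_preimage_shift`), with
  `α₄,ₜ(1, d) = P_t(fourArmTwoClusters 1 d)` (`= zdFourArmProbAt t 1 d` of `ZdNearCriticalWindow.lean`).

The converse direction (a lower bound of `P_t(e pivotal)` by a four-arm probability) is the
arm-separation half of the printed argument and is NOT treated here.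
-/

noncomputable section

open MeasureTheory Set
open scoped unitInterval

namespace Literature.Probability.Percolation

open LatticeModels

/-! ### A cut lemma -/

/-- A set of vertices which is closed under adjacency contains every vertex reachable from one
of its elements. [folklore] -/
theorem ZdPivotal.mem_of_reachable_of_closed {V : Type*} {H : SimpleGraph V} {C : Set V}
    (hC : ∀ ⦃a b : V⦄, a ∈ C → H.Adj a b → b ∈ C) {x y : V} (h : H.Reachable x y) (hx : x ∈ C) :
    y ∈ C := by
  obtain ⟨w⟩ := h
  induction w with
  | nil => exact hx
  | cons hadj w ih => exact ih (hC hx hadj)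

/-! ### Pivotal edges separate the left cluster from the right cluster -/

/-- Adjacency in the open graph of `ω ∪ {e}` induced on `S`: either the edge is `e`, or it is an
open edge of `ω ∖ {e}`. [folklore] -/
theorem ZdPivotal.induce_adj_insert {V : Type*} {ω : BondConfig V} {e : Sym2 V} {S : Set V}
    {a b : S} (h : ((openGraph (insert e ω)).induce S).Adj a b) :
    ((openGraph (ω \ {e})).induce S).Adj a b ∨ s((a : V), b) = e := by
  simp only [SimpleGraph.comap_adj, Function.Embedding.coe_subtype, openGraph_adj,
    mem_insert_iff, mem_sdiff, mem_singleton_iff] at h ⊢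
  obtain ⟨h1 | h1, hne⟩ := h
  · exact Or.inr h1
  · by_cases he : s((a : V), b) = e
    · exact Or.inr he
    · exact Or.inl ⟨⟨h1, he⟩, hne⟩

/-- **A pivotal edge of the square crossing separates the left cluster from the right cluster.**
If `e` is pivotal for `LR([0,N]²)` in `ω`, then `e = {a, b}` with `a ≠ b` in the square such that,
in the configuration `ω ∖ {e}` and inside the square, `a` is joined to the left side but to no
site of the right side, and `b` is joined to the right side but to no site of the left side
(Nolin 2008, §7.3, first paragraph, cluster form; Kesten 1987, §2). Proof: the set of sites joined
to the left side in `ω ∖ {e}` is closed under the open edges of `ω ∖ {e}` and misses the right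
side, while `ω ∪ {e}` joins the two sides; so `e` exits that set, and symmetrically for the right
side; the two exits are oppositely oriented since `ω ∖ {e}` has no crossing. [cite: Nolin2008, §7.3 (first paragraph: pivotal sites and the four-arm event)] -/
theorem exists_endpoints_of_isPivotal_lrCrossing {N : ℕ} {e : Sym2 (Site 2)} {ω : BondConfig (Site 2)}
    (hpiv : IsPivotal (lrCrossing N N) e ω) :
    ∃ a b : Site 2, s(a, b) = e ∧ a ≠ b ∧
      (∃ l ∈ leftSide N N, ω \ {e} ∈ openConnIn ↑(rectangle N N) l a) ∧
      (∀ r ∈ rightSide N N, ω \ {e} ∉ openConnIn ↑(rectangle N N) a r) ∧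
      (∃ r ∈ rightSide N N, ω \ {e} ∈ openConnIn ↑(rectangle N N) b r) ∧
      (∀ l ∈ leftSide N N, ω \ {e} ∉ openConnIn ↑(rectangle N N) l b) := by
  classical
  set S : Set (Site 2) := ↑(rectangle N N) with hSdef
  obtain ⟨hplus, hminus⟩ : insert e ω ∈ lrCrossing N N ∧ ω \ {e} ∉ lrCrossing N N := by
    rcases hpiv with ⟨h1, h2⟩ | ⟨h1, h2⟩
    · exact ⟨h1, h2⟩
    · exact absurd (isUpperSet_lrCrossing N N (sdiff_subset.trans (subset_insert e ω)) h1) h2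
  set Gm : SimpleGraph S := (openGraph (ω \ {e})).induce S with hGm
  set Gp : SimpleGraph S := (openGraph (insert e ω)).induce S with hGp
  -- the crossing of `ω ∪ {e}`
  obtain ⟨l, hl, r, hr, hlS, hrS, hreach⟩ :
      ∃ l ∈ leftSide N N, ∃ r ∈ rightSide N N, ∃ (hlS : l ∈ S) (hrS : r ∈ S),
        Gp.Reachable ⟨l, hlS⟩ ⟨r, hrS⟩ := by
    obtain ⟨l, hl, r, hr, hlS, hrS, hreach⟩ := hplus
    exact ⟨l, hl, r, hr, hlS, hrS, hreach⟩
  -- no crossing in `ω ∖ {e}`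
  have hno : ∀ l' ∈ leftSide N N, ∀ r' ∈ rightSide N N, ∀ (hl' : l' ∈ S) (hr' : r' ∈ S),
      ¬ Gm.Reachable ⟨l', hl'⟩ ⟨r', hr'⟩ := fun l' hl' r' hr' hl'S hr'S hc =>
    hminus ⟨l', hl', r', hr', hl'S, hr'S, hc⟩
  -- the left cluster and the right cluster of `ω ∖ {e}`
  set CL : Set S := {x | ∃ l' : S, (l' : Site 2) ∈ leftSide N N ∧ Gm.Reachable l' x} with hCL
  set CR : Set S := {x | ∃ r' : S, (r' : Site 2) ∈ rightSide N N ∧ Gm.Reachable x r'} with hCR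
  have hCLm : ∀ ⦃a b : S⦄, a ∈ CL → Gm.Adj a b → b ∈ CL := fun a b ⟨l', hl', hla⟩ hab =>
    ⟨l', hl', hla.trans hab.reachable⟩
  have hCRm : ∀ ⦃a b : S⦄, a ∈ CR → Gm.Adj a b → b ∈ CR := fun a b ⟨r', hr', har⟩ hab =>
    ⟨r', hr', hab.symm.reachable.trans har⟩
  have hlCL : (⟨l, hlS⟩ : S) ∈ CL := ⟨⟨l, hlS⟩, hl, SimpleGraph.Reachable.refl _⟩
  have hrCR : (⟨r, hrS⟩ : S) ∈ CR := ⟨⟨r, hrS⟩, hr, SimpleGraph.Reachable.refl _⟩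
  have hrCL : (⟨r, hrS⟩ : S) ∉ CL := fun ⟨l', hl', h⟩ => hno l' hl' r hr l'.2 hrS h
  have hlCR : (⟨l, hlS⟩ : S) ∉ CR := fun ⟨r', hr', h⟩ => hno l hl r' hr' hlS r'.2 h
  -- `e` exits the left cluster
  obtain ⟨a, b, haCL, hab, hbCL⟩ : ∃ a b : S, a ∈ CL ∧ Gp.Adj a b ∧ b ∉ CL := by
    by_contra hcon
    push Not at hcon
    exact hrCL (ZdPivotal.mem_of_reachable_of_closed (fun a b ha h => hcon a b ha h) hreach hlCL)
  have he₁ : s((a : Site 2), b) = e := by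
    rcases ZdPivotal.induce_adj_insert hab with h | h
    · exact absurd (hCLm haCL h) hbCL
    · exact h
  -- `e` exits the right cluster (walking back from `r`)
  obtain ⟨a', b', haCR, hab', hbCR⟩ : ∃ a b : S, a ∈ CR ∧ Gp.Adj a b ∧ b ∉ CR := by
    by_contra hcon
    push Not at hcon
    exact hlCR (ZdPivotal.mem_of_reachable_of_closed (fun a b ha h => hcon a b ha h) hreach.symm hrCR)
  have he₂ : s((a' : Site 2), b') = e := by
    rcases ZdPivotal.induce_adj_insert hab' with h | h
    · exact absurd (hCRm haCR h) hbCR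
    · exact h
  -- the two exits are the same edge, oppositely oriented
  have hne : (a : Site 2) ≠ b := fun h => hab.ne (Subtype.ext h)
  have hcases : ((a : Site 2) = a' ∧ (b : Site 2) = b') ∨ ((a : Site 2) = b' ∧ (b : Site 2) = a') :=
    Sym2.eq_iff.1 (he₁.trans he₂.symm)
  rcases hcases with ⟨h1, -⟩ | ⟨h1, h2⟩
  · -- same orientation: `a` is joined to both sides in `ω ∖ {e}`, a crossing
    exfalso
    have ha' : a ∈ CR := by rw [show a = a' from Subtype.ext h1]; exact haCR
    obtain ⟨l', hl', hla⟩ := haCL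
    obtain ⟨r', hr', har⟩ := ha'
    exact hno l' hl' r' hr' l'.2 r'.2 (hla.trans har)
  · have hbCR' : b ∈ CR := by rw [show b = a' from Subtype.ext h2]; exact haCR
    have haCR' : a ∉ CR := by rw [show a = b' from Subtype.ext h1]; exact hbCR
    refine ⟨a, b, he₁, hne, ?_, ?_, ?_, ?_⟩
    · obtain ⟨l', hl', hla⟩ := haCL
      exact ⟨l', hl', l'.2, a.2, hla⟩
    · intro r' hr' hc
      obtain ⟨_, hr'S, hc⟩ := hc
      exact haCR' ⟨⟨r', hr'S⟩, hr', hc⟩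
    · obtain ⟨r', hr', hbr⟩ := hbCR'
      exact ⟨r', hr', b.2, r'.2, hbr⟩
    · intro l' hl' hc
      obtain ⟨hl'S, _, hc⟩ := hc
      exact hbCL ⟨⟨l', hl'S⟩, hl', hc⟩


/-! ### Four arms around an endpoint of a pivotal edge -/

/-- A lattice neighbour `x` of `c` has `x - c` on the unit sup-norm sphere. [folklore] -/
theorem ZdPivotal.sub_mem_siteSphere_one_of_adj {c x : Site 2} (h : (zdGraph 2).Adj c x) :
    x - c ∈ siteSphere 1 := by
  simp only [siteSphere, Finset.mem_sdiff, mem_box]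
  obtain ⟨j, hj | hj⟩ := (zdGraph_adj_iff c x).1 h
  · have h3 : ∀ i, (x - c) i = (Pi.single j (1 : ℤ) : Site 2) i := fun i => by rw [hj]; simp
    refine ⟨fun i => ?_, fun h0 => ?_⟩
    · rw [h3, Pi.single_apply]; split_ifs <;> simp
    · have := h0 j; rw [h3, Pi.single_apply, if_pos rfl] at this; simp at this
  · have h3 : ∀ i, (x - c) i = -(Pi.single j (1 : ℤ) : Site 2) i := fun i => by rw [hj]; simp
    refine ⟨fun i => ?_, fun h0 => ?_⟩
    · rw [h3, Pi.single_apply]; split_ifs <;> simp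
    · have := h0 j; rw [h3, Pi.single_apply, if_pos rfl] at this; simp at this

/-- A lattice step moves `x - c` from the box `[-k,k]²` into `[-(k+1), k+1]²`. [folklore] -/
theorem ZdPivotal.sub_mem_box_succ_of_adj {c x z : Site 2} {k : ℕ} (hx : x - c ∈ box 2 k)
    (h : (zdGraph 2).Adj x z) : z - c ∈ box 2 (k + 1) := by
  rw [mem_box] at hx ⊢
  obtain ⟨j, hj | hj⟩ := (zdGraph_adj_iff x z).1 h
  · intro i
    have h2 := hx i
    have h3 : (z - c) i = (x - c) i + (Pi.single j (1 : ℤ) : Site 2) i := by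
      rw [hj]; simp; ring
    rw [Pi.single_apply] at h3
    push_cast
    split_ifs at h3 <;> omega
  · intro i
    have h2 := hx i
    have h3 : (x - c) i = (z - c) i + (Pi.single j (1 : ℤ) : Site 2) i := by
      rw [hj]; simp; ring
    rw [Pi.single_apply] at h3
    push_cast
    split_ifs at h3 <;> omega

/-- `x - c ∉ [-0,0]²` iff `x ≠ c`. [folklore] -/
theorem ZdPivotal.sub_notMem_box_zero_iff {c x : Site 2} : x - c ∉ box 2 0 ↔ x ≠ c := by
  rw [not_iff_not, mem_box]
  constructor
  · intro h
    ext i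
    have := h i
    have h0 : (x - c) i = 0 := by push_cast at this; omega
    simpa [sub_eq_zero] using h0
  · rintro rfl i
    simp

/-- **An open path from `x` leaving the box `c + [-(d-1), d-1]²` contains an open crossing of the
punctured box** `{y | y - c ∈ A_{1,d}}` from `x` to a site `y` with `y - c` on the sphere of radius
`d`, provided the path avoids `c` (first exit from the box; cf. `exists_openConnIn_sqAnnulus_of_le_right`).
[folklore] -/
theorem ZdPivotal.exists_arm_of_walk {ω : BondConfig (Site 2)} {c x t : Site 2} {d : ℕ} (hd : 1 ≤ d)
    (q : (zdGraph 2).Walk x t) (hqc : c ∉ q.support) (hqω : ∀ e ∈ q.edges, e ∈ ω)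
    (hx : x - c ∈ box 2 d) (ht : t - c ∉ box 2 (d - 1)) :
    ∃ y, y - c ∈ siteSphere d ∧ y ∈ q.support ∧
      ω ∈ openConnIn {z | z - c ∈ sqAnnulus 1 d} x y := by
  have hT : ∀ z, z - c ∈ box 2 d → z ≠ c → z ∈ ({z | z - c ∈ sqAnnulus 1 d} : Set (Site 2)) :=
    fun z hz hzc => by
      simp only [mem_setOf_eq, sqAnnulus, Finset.mem_coe, mem_annulus, Nat.sub_self]
      exact ⟨hz, ZdPivotal.sub_notMem_box_zero_iff.2 hzc⟩
  have hxc : x ≠ c := fun h => hqc (h ▸ q.start_mem_support)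
  by_cases hxb : x - c ∈ box 2 (d - 1)
  · obtain ⟨x', z, q₁, hxz, hz, hA, hS, hE, hlast⟩ :=
      exists_prefix_exit (A := {z | z - c ∈ box 2 (d - 1)}) q hxb ht
    have hzb : z - c ∈ box 2 d := by
      have := ZdPivotal.sub_mem_box_succ_of_adj (hA x' q₁.end_mem_support) hxz
      rwa [Nat.sub_add_cancel hd] at this
    have hzs : z - c ∈ siteSphere d := Finset.mem_sdiff.2 ⟨hzb, hz⟩
    have hzq : z ∈ q.support := q.snd_mem_support_of_mem_edges hlast
    refine ⟨z, hzs, hzq, mem_openConnIn_of_walk (q₁.concat hxz) (fun v hv => ?_) (fun e he => ?_)⟩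
    · rw [SimpleGraph.Walk.support_concat, List.mem_append, List.mem_singleton] at hv
      rcases hv with hv | rfl
      · exact hT v (box_mono 2 (Nat.sub_le d 1) (hA v hv)) fun h => hqc (h ▸ hS v hv)
      · exact hT _ hzb fun h => hqc (h ▸ hzq)
    · rw [SimpleGraph.Walk.edges_concat, List.concat_eq_append, List.mem_append,
        List.mem_singleton] at he
      rcases he with he | rfl
      · exact hqω e (hE e he)
      · exact hqω _ hlast
  · have hxs : x - c ∈ siteSphere d := Finset.mem_sdiff.2 ⟨hx, hxb⟩
    exact ⟨x, hxs, q.start_mem_support, openConnIn_refl (hT x hx hxc)⟩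

/-- A self-avoiding walk with distinct endpoints starts with an edge `u ∼ x` followed by a
self-avoiding walk from `x` avoiding `u`. [folklore] -/
theorem ZdPivotal.exists_cons_of_isPath {V : Type*} {G : SimpleGraph V} {u v : V} (p : G.Walk u v)
    (hp : p.IsPath) (hne : u ≠ v) :
    ∃ (x : V) (_ : G.Adj u x) (q : G.Walk x v), q.IsPath ∧ u ∉ q.support ∧
      (∀ z ∈ q.support, z ∈ p.support) ∧ (∀ e ∈ q.edges, e ∈ p.edges) ∧ s(u, x) ∈ p.edges := by
  cases p with
  | nil => exact absurd rfl hne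
  | cons h q =>
    rw [SimpleGraph.Walk.cons_isPath_iff] at hp
    exact ⟨_, h, q, hp.1, hp.2, fun z hz => by simp [hz], fun e he => by simp [he], by simp⟩

/-- **Four arms around an endpoint of a separating edge, then translation to the origin.** Let
`ω` be a lattice configuration, `c ∼ c'` a lattice edge, `d ≥ 1`, `S` a set of sites containing
the box `c + [-d,d]²`, and suppose that in `ω ∖ {cc'}` and inside `S`: `c` is joined to a site
`l` outside `c + [-(d-1),d-1]²`, `c'` is joined to a site `r` outside that box, and `c` is not
joined to `r`. Then the configuration translated by `-c` has two open crossings of `A_{1,d}` in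
distinct open clusters of the annulus, i.e. lies in `fourArmTwoClusters 1 d` (Nolin 2008, §7.3,
first paragraph: pivotal ⇒ four alternating arms, in the cluster form of `FourArmGarban.lean`).
Proof: an open self-avoiding path from `c` to `l` leaves `c` through a neighbour `x₁` and never
returns; an open path from `c'` to `r` cannot visit `c` (it would join `c` to `r`); stop both at
their first exit from `c + [-(d-1),d-1]²`; a junction of `x₁` and `c'` inside the punctured box
would avoid the edge `cc'` and again join `c` to `r`. [cite: Nolin2008, §7.3 (first paragraph)] -/
theorem relabel_mem_fourArmTwoClusters_of_arms {ω : BondConfig (Site 2)}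
    (hω : ω ⊆ (zdGraph 2).edgeSet) {c c' : Site 2} (hcc' : (zdGraph 2).Adj c c') {d : ℕ}
    (hd : 1 ≤ d) {S : Set (Site 2)} (hS : ∀ x, x - c ∈ box 2 d → x ∈ S) {l r : Site 2}
    (hl : l - c ∉ box 2 (d - 1)) (h1 : ω \ {s(c, c')} ∈ openConnIn S c l)
    (hr : r - c ∉ box 2 (d - 1)) (h2 : ω \ {s(c, c')} ∈ openConnIn S c' r)
    (h3 : ω \ {s(c, c')} ∉ openConnIn S c r) :
    BondConfig.relabel (sym2Equiv (Site.shift (-c))) ω ∈ fourArmTwoClusters 1 d := by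
  classical
  set e : Sym2 (Site 2) := s(c, c') with he
  set T : Set (Site 2) := {z | z - c ∈ sqAnnulus 1 d} with hTdef
  have hω' : ω \ {e} ⊆ (zdGraph 2).edgeSet := sdiff_subset.trans hω
  have hTS : T ⊆ S := fun z hz => by
    simp only [hTdef, mem_setOf_eq, sqAnnulus, Finset.mem_coe, mem_annulus] at hz
    exact hS z hz.1
  have hcT : c ∉ T := by
    simp [hTdef, sqAnnulus, mem_annulus]
  -- first arm: a self-avoiding open path from `c` to `l`
  obtain ⟨p₀, hp₀S, hp₀ω⟩ := exists_walk_of_mem_openConnIn hω' h1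
  set p := p₀.bypass with hp
  have hpS : ∀ z ∈ p.support, z ∈ S := fun z hz => hp₀S z (p₀.support_bypass_subset_support hz)
  have hpω : ∀ e' ∈ p.edges, e' ∈ ω \ {e} := fun e' he' => hp₀ω e' (p₀.edges_bypass_subset_edges he')
  have hpath : p.IsPath := p₀.bypass_isPath
  have hcl : c ≠ l := by
    rintro rfl
    exact hl (by simp)
  obtain ⟨x₁, hcx₁, q, -, hcq, hqS, hqE, hfirst⟩ := ZdPivotal.exists_cons_of_isPath p hpath hcl
  have hx₁s : x₁ - c ∈ siteSphere 1 := ZdPivotal.sub_mem_siteSphere_one_of_adj hcx₁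
  have hx₁b : x₁ - c ∈ box 2 d := box_mono 2 hd (Finset.mem_sdiff.1 hx₁s).1
  obtain ⟨y₁, hy₁s, -, harm₁⟩ := ZdPivotal.exists_arm_of_walk hd q hcq
    (fun e' he' => (hpω e' (hqE e' he')).1) hx₁b hl
  have hcx₁' : ω \ {e} ∈ openConnIn S c x₁ :=
    openConnIn_of_adj (hpS c p.start_mem_support) (hpS x₁ (hqS x₁ q.start_mem_support))
      (hpω _ hfirst) hcx₁.ne
  -- second arm: an open path from `c'` to `r`, which cannot visit `c`
  obtain ⟨Q, hQS, hQω⟩ := exists_walk_of_mem_openConnIn hω' h2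
  have hcQ : c ∉ Q.support := fun hc =>
    h3 (PlanarDuality.openConnIn_trans
      (by rw [openConnIn_comm]; exact mem_openConnIn_of_mem_support Q hQS hQω hc) h2)
  have hc's : c' - c ∈ siteSphere 1 := ZdPivotal.sub_mem_siteSphere_one_of_adj hcc'
  have hc'b : c' - c ∈ box 2 d := box_mono 2 hd (Finset.mem_sdiff.1 hc's).1
  obtain ⟨y₂, hy₂s, -, harm₂⟩ := ZdPivotal.exists_arm_of_walk hd Q hcQ
    (fun e' he' => (hQω e' he').1) hc'b hr
  -- the two arms lie in distinct open clusters of the punctured box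
  have hsep : ω ∉ openConnIn T x₁ c' := fun hbad => by
    obtain ⟨W, hWT, hWω⟩ := exists_walk_of_mem_openConnIn hω hbad
    have hWe : ∀ e' ∈ W.edges, e' ∈ ω \ {e} := fun e' he' =>
      ⟨hWω e' he', fun hee => by
        rw [mem_singleton_iff] at hee
        rw [hee] at he'
        exact hcT (hWT c (W.fst_mem_support_of_mem_edges he'))⟩
    have hW : ω \ {e} ∈ openConnIn S x₁ c' :=
      mem_openConnIn_of_walk W (fun z hz => hTS (hWT z hz)) hWe
    exact h3 (PlanarDuality.openConnIn_trans (PlanarDuality.openConnIn_trans hcx₁' hW) h2)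
  -- translate by `-c`
  set φ : Site 2 ≃ Site 2 := Site.shift (-c) with hφdef
  have hφ : ∀ x, φ x = x - c := fun x => by
    simp [hφdef, sub_eq_add_neg]
  have himg : φ '' T = sqAnnulus 1 d := by
    ext z
    constructor
    · rintro ⟨x, hx, rfl⟩
      rw [hφ]; exact hx
    · intro hz
      refine ⟨z + c, ?_, ?_⟩
      · show z + c - c ∈ sqAnnulus 1 d
        rwa [add_sub_cancel_right]
      · rw [hφ, add_sub_cancel_right]
  refine ⟨φ x₁, ?_, φ c', ?_, φ y₁, ?_, φ y₂, ?_, ?_, ?_, ?_⟩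
  · rw [hφ]; exact hx₁s
  · rw [hφ]; exact hc's
  · rw [hφ]; exact hy₁s
  · rw [hφ]; exact hy₂s
  · have := relabel_mem_openConnIn φ harm₁; rwa [himg] at this
  · have := relabel_mem_openConnIn φ harm₂; rwa [himg] at this
  · intro hbad
    apply hsep
    have h' := relabel_mem_openConnIn φ.symm hbad
    rw [relabel_symm_relabel, Equiv.symm_apply_apply, Equiv.symm_apply_apply, ← himg,
      Equiv.symm_image_image] at h'
    exact h'


/-! ### The probability bound -/

/-- Sites at sup-distance `≤ d` from a site whose coordinates lie in `[d, N-d]` belong to the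
square `[0,N]²`. [folklore] -/
theorem ZdPivotal.mem_rectangle_of_sub_mem_box {N d : ℕ} {u x : Site 2}
    (hu : (d : ℤ) ≤ u 0 ∧ u 0 + d ≤ N ∧ (d : ℤ) ≤ u 1 ∧ u 1 + d ≤ N) (hx : x - u ∈ box 2 d) :
    x ∈ (↑(rectangle N N) : Set (Site 2)) := by
  rw [Finset.mem_coe, mem_rectangle_iff]
  rw [mem_box] at hx
  have h0 := hx 0
  have h1 := hx 1
  simp only [Pi.sub_apply] at h0 h1
  omega

/-- **On lattice configurations, a pivotal edge deep inside the square carries four arms around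
one of its endpoints**: if `e = {u, v}` is a lattice edge whose endpoints have coordinates in
`[d, N-d]` (`d ≥ 1`) and `e` is pivotal for `LR([0,N]²)` in `ω ⊆ E(ℤ²)`, then the configuration
translated by `-u` or by `-v` lies in `fourArmTwoClusters 1 d` (Nolin 2008, §7.3, first
paragraph; the centre is the endpoint joined to the left side). [cite: Nolin2008, §7.3 (first paragraph)] -/
theorem relabel_mem_fourArmTwoClusters_of_isPivotal {N d : ℕ} (hd : 1 ≤ d) {u v : Site 2}
    (huv : (zdGraph 2).Adj u v)
    (hu : (d : ℤ) ≤ u 0 ∧ u 0 + d ≤ N ∧ (d : ℤ) ≤ u 1 ∧ u 1 + d ≤ N)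
    (hv : (d : ℤ) ≤ v 0 ∧ v 0 + d ≤ N ∧ (d : ℤ) ≤ v 1 ∧ v 1 + d ≤ N)
    {ω : BondConfig (Site 2)} (hω : ω ⊆ (zdGraph 2).edgeSet)
    (hpiv : IsPivotal (lrCrossing N N) s(u, v) ω) :
    BondConfig.relabel (sym2Equiv (Site.shift (-u))) ω ∈ fourArmTwoClusters 1 d ∨
      BondConfig.relabel (sym2Equiv (Site.shift (-v))) ω ∈ fourArmTwoClusters 1 d := by
  obtain ⟨a, b, hab, -, ⟨l, hl, h1⟩, hnr, ⟨r, hr, h2⟩, -⟩ :=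
    exists_endpoints_of_isPivotal_lrCrossing hpiv
  -- geometry of the far endpoints, for a centre `c` with coordinates in `[d, N-d]`
  have hfar : ∀ {c : Site 2}, ((d : ℤ) ≤ c 0 ∧ c 0 + d ≤ N ∧ (d : ℤ) ≤ c 1 ∧ c 1 + d ≤ N) →
      l - c ∉ box 2 (d - 1) ∧ r - c ∉ box 2 (d - 1) := by
    intro c hc
    have hl0 : l 0 = 0 := (Finset.mem_filter.1 hl).2
    have hr0 : r 0 = N := (Finset.mem_filter.1 hr).2
    constructor
    · intro h
      have := (mem_box.1 h 0).1
      simp only [Pi.sub_apply] at this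
      omega
    · intro h
      have := (mem_box.1 h 0).2
      simp only [Pi.sub_apply] at this
      omega
  have key : ∀ {c c' : Site 2}, s(c, c') = s(u, v) → (zdGraph 2).Adj c c' →
      ((d : ℤ) ≤ c 0 ∧ c 0 + d ≤ N ∧ (d : ℤ) ≤ c 1 ∧ c 1 + d ≤ N) →
      ω \ {s(u, v)} ∈ openConnIn ↑(rectangle N N) l c →
      ω \ {s(u, v)} ∈ openConnIn ↑(rectangle N N) c' r →
      ω \ {s(u, v)} ∉ openConnIn ↑(rectangle N N) c r →
      BondConfig.relabel (sym2Equiv (Site.shift (-c))) ω ∈ fourArmTwoClusters 1 d := by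
    intro c c' hcc' hadj hc g1 g2 g3
    rw [← hcc'] at g1 g2 g3
    rw [openConnIn_comm] at g1
    exact relabel_mem_fourArmTwoClusters_of_arms hω hadj hd
      (fun x hx => ZdPivotal.mem_rectangle_of_sub_mem_box hc hx) (hfar hc).1 g1 (hfar hc).2 g2 g3
  rcases Sym2.eq_iff.1 hab with ⟨rfl, rfl⟩ | ⟨rfl, rfl⟩
  · exact Or.inl (key rfl huv hu h1 h2 (hnr r hr))
  · exact Or.inr (key Sym2.eq_swap huv.symm hv h1 h2 (hnr r hr))

/-- **`P_t(e pivotal for LR([0,N]²)) ≤ 2 α₄,ₜ(1, d)` for edges deep inside the square** (Nolin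
2008, §7.3, proof of Prop. 32: "`P̂(v ⇝^{4,σ₄,Ī} ∂[0,L(p)]²) ≍ P̂(v ⇝^{4,σ₄} ∂S_{ηL(p)}(v))`", the
`≤` half, for bond percolation on `ℤ²` and the cluster form `fourArmTwoClusters` of the four-arm
event; Werner 2009, Lecture 6, proof of Lemma 6.2): for a lattice edge `e = {u,v}` whose endpoints
have coordinates in `[d, N-d]`, the event that `e` is pivotal is covered by the two translates
(by `u` and by `v`) of `fourArmTwoClusters 1 d`, each of probability `α₄,ₜ(1,d) = P_t(fourArmTwoClusters 1 d)`
(`zdFourArmProbAt t 1 d`) by translation invariance. [cite: Nolin2008, §7.3, proof of Prop. 34 (arXiv 0711.4948: Prop. 32)] -/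
theorem real_isPivotal_lrCrossing_le (t : unitInterval) {N d : ℕ} (hd : 1 ≤ d) {u v : Site 2}
    (huv : (zdGraph 2).Adj u v)
    (hu : (d : ℤ) ≤ u 0 ∧ u 0 + d ≤ N ∧ (d : ℤ) ≤ u 1 ∧ u 1 + d ≤ N)
    (hv : (d : ℤ) ≤ v 0 ∧ v 0 + d ≤ N ∧ (d : ℤ) ≤ v 1 ∧ v 1 + d ≤ N) :
    (bondPercolation (zdGraph 2) t).real {ω | IsPivotal (lrCrossing N N) s(u, v) ω} ≤
      2 * (bondPercolation (zdGraph 2) t).real (fourArmTwoClusters 1 d) := by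
  set μ := bondPercolation (zdGraph 2) t with hμ
  set Fu : Set (BondConfig (Site 2)) :=
    BondConfig.relabel (sym2Equiv (Site.shift (-u))) ⁻¹' fourArmTwoClusters 1 d with hFu
  set Fv : Set (BondConfig (Site 2)) :=
    BondConfig.relabel (sym2Equiv (Site.shift (-v))) ⁻¹' fourArmTwoClusters 1 d with hFv
  calc μ.real {ω | IsPivotal (lrCrossing N N) s(u, v) ω}
      ≤ μ.real (Fu ∪ Fv) := by
        refine ENNReal.toReal_mono (measure_ne_top _ _) (measure_mono_ae ?_)
        have hae : ∀ᵐ ω ∂μ, ω ⊆ (zdGraph 2).edgeSet := ProbabilityTheory.setBernoulli_ae_subset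
        filter_upwards [hae] with ω hω hpiv
        exact relabel_mem_fourArmTwoClusters_of_isPivotal hd huv hu hv hω hpiv
    _ ≤ μ.real Fu + μ.real Fv := measureReal_union_le _ _
    _ = 2 * μ.real (fourArmTwoClusters 1 d) := by
        rw [hFu, hFv, hμ, bondPercolation_real_preimage_shift, bondPercolation_real_preimage_shift]
        ring

/-- The same bound for the summand of `zdSquarePivotalSum` (which also records that `e` is a
lattice edge). [cite: Nolin2008, §7.3, proof of Prop. 34 (arXiv 0711.4948: Prop. 32)] -/
theorem real_edge_isPivotal_lrCrossing_le (t : unitInterval) {N d : ℕ} (hd : 1 ≤ d) {u v : Site 2}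
    (huv : (zdGraph 2).Adj u v)
    (hu : (d : ℤ) ≤ u 0 ∧ u 0 + d ≤ N ∧ (d : ℤ) ≤ u 1 ∧ u 1 + d ≤ N)
    (hv : (d : ℤ) ≤ v 0 ∧ v 0 + d ≤ N ∧ (d : ℤ) ≤ v 1 ∧ v 1 + d ≤ N) :
    (bondPercolation (zdGraph 2) t).real
        {ω | s(u, v) ∈ (zdGraph 2).edgeSet ∧ IsPivotal (lrCrossing N N) s(u, v) ω} ≤
      2 * (bondPercolation (zdGraph 2) t).real (fourArmTwoClusters 1 d) :=
  (measureReal_mono (fun _ h => h.2)).trans (real_isPivotal_lrCrossing_le t hd huv hu hv)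

end Literature.Probability.Percolation
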